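import Summits.Ventures.YMGap.RobustBall.CentreBlindZ2PerimeterTwoSides
import Summits.Ventures.YMGap.RobustBall.ErgodicConcentration
import Summits.Ventures.YMGap.RobustBall.StarBoundaryDecayZd
import Summits.Ventures.YMGap.RobustBall.StarKernelClusteringZd
import Summits.Ventures.YMGap.RobustBall.BoundaryFreeEnergy
import HarnessLib

/-!
# Venture statement — YMGap (cell `pub-ymgap`) — CONJUNCT BODIES T77, T78, T79, T80, T81 (V23F, block 1)

STATUS: FILED by p3 g11 as V23F = T77 + T78 + T79 + T80 + T81 on lead g12's ★ V23F YES (chair, bus 2026-08-24T23:33:06Z, INBOX l.6944 (1), procedural under ★ R322 (4) / ★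
R324 (4), no new R-number), quoted: «p3 (g11) l.6941 ★ V23F BOOKING — YES exactly as asked (R322∕R324 precedent): `StatementConjunctsV23F.lean` = T77
`T77_CentreBlindZ2Perimeter` (ds-4 g12 text c 68d23e87f73fa6db) + T78 (ds-3 g14 part G, complete Hsu–Robbins-type convergence at the SU(2) Wilson point) + T79 (ds-3 g15
part J, ℤ⁴ boundary decay at the star rate) (+ any set that turns GREEN-by-import before your final-sha line, numbered T80+ in GREEN order and ANNOUNCED FIRST on this
bus); owners' window to 00:40Z (silence = consent; ds-4∕ds-3 named); referee g36 pre-audit of the candidate bytes; ONE final-sha line; then ONE dry-run + ONE `--review`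
filing + ONE wait under R313, NOT queued behind another review-lane file of yours; index order afterwards v1.16 (V23D) → v1.17 (V23E) → v1.18 (V23F), each olean-gated …
HONEST-FRAMING sentences as you wrote them … keep them verbatim in the header». T80 and T81 turned GREEN-by-import after the 00:17–00:25Z olean trickle (2026-08-25) and
were ANNOUNCED FIRST on the bus (p3 g11, INBOX l.7135) before this final-sha line, as that YES requires. Owner consents: ds-4 g12 countersign in the owner file's header
(«these bytes are the text of record from this seat; p3 may rename / renumber / fold, bodies unchanged») + bus l.5854 / l.6113 (T77; no correction by the 00:40Z window);
ds-3 g17 ★ NO-OBJECTION to T78 / T79, bus l.6972 (23:40:15Z); T80 (ds-3 g15 part K, owner line l.6467) and T81 (ds-3 g17 part A, owner line l.7021 «numbering yours») —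
ds-3 g17 named in l.7135 with a window to this line (ds-3 g17 re-announced text A GREEN by import at l.7152, 00:42:54Z, «numbering yours»; the chair (lead g13) ★★ R347
(E), l.7155: «text A … is ALREADY T81 of p3's V23F candidate3 … — not V23G»; no correction to T80/T81 by this line). Referee pre-audits: F-672 (g36, bus l.6947) on the
T77–T79 candidate 2d8fdc1fcd9fd150 — mono 6/6 ALL-STD, parents and owner snapshots re-hashed, bytecmp 51/51 + 31/31 + 33/33, CLEAN TO FILE; F-689 (g36, bus l.7140,
00:38Z) on the GROWN candidate db4468bedfa99fbd (294 l) — mono 10/10 std, bytecmp 51/51 + 31/31 + 33/33 + 34/34 + 36/36, owner snapshots = live files, five parents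
re-hashed, T80/T81 statement-exact ∀-closures, CLEAN TO FILE; this FINAL differs from the grown candidate in the present STATUS sentence only (decl lines identical).
Numbers T77, T78, T79, T80, T81 assigned by p3 under lead g10's delegation (bus 2026-08-24T09:03:51Z «T-numbers (T71+) are p3's to assign»; ★ R322 (4) / ★ R324 (4); chair
g12 2026-08-24T20:31:19Z INBOX l.6473 (B) «a set turning GREEN after your final-sha line goes to the NEXT block (V23F) … next free T77») in GREEN order = order of the
owners' READY lines, announced on the bus before filing. GREEN = parents are TREE modules with built oleans and the owner file answers a by-import `lean check` rc 0 / 0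
warnings / std axioms: T77 — ds-4 g12 text c `HOME/ds/ds4/lean/fisher/V24ConjunctDS4g12c.lean` 68d23e87f73fa6db (owner countersign in its header + bus l.5854 / l.6113;
parent `RobustBall/CentreBlindZ2PerimeterTwoSides` ds-4 p386873 79903961733c, tree bytes 5d548a8f86104a0c, olean ctime 23:13:31Z 2026-08-24) rc 0 at 23:31Z; T78 — ds-3
g14 part G `HOME/ds/ds3/lean/g14/texts/V1XConjunctsDS3g14G.lean` ac24291bbe1e9a91 (owner READY line bus l.6169; parent `RobustBall/ErgodicConcentration` ds-3 p383242
97a65abce363, tree bytes 537538d5f70c7c43, olean ctime 21:44:09Z) rc 0 at 23:31Z; T79 — ds-3 g15 part J `HOME/ds/ds3/lean/g15/texts/V1XConjunctsDS3g15J.lean`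
2a6aa2388ad2c053 (owner READY lines bus l.6287 / l.6305; parent `RobustBall/StarBoundaryDecayZd` ds-3 p384439 63ccd2a7bcc9, tree bytes 12ee650198365e85, olean ctime
21:44:09Z) rc 0 at 23:31Z; T80 — GREEN AFTER the T77–T79 candidate (2d8fdc1fcd9fd150, referee F-672) and BEFORE the final-sha line, announced first on the bus: ds-3 g15
part K `HOME/ds/ds3/lean/g15/texts/V1XConjunctsDS3g15K.lean` 8a845bf466578715 (owner line bus l.6467, ds-3 g16; parent `RobustBall/StarKernelClusteringZd` ds-3 p385592
8563f1886dc2, tree bytes acae55a542f8fa9f, olean ctime 00:20:33Z 2026-08-25) rc 0 at 00:35Z; T81 — likewise: ds-3 g17 part A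
`HOME/ds/ds3/lean/g17/texts/V1XConjunctsDS3g17A.lean` b484d36f06b6b40e (owner line bus l.7021; parent `RobustBall/BoundaryFreeEnergy` ds-3 p387913 e9fb62b626bf, tree
bytes 0b05d5ab7ac427fb, olean ctime 00:24Z 2026-08-25) rc 0 at 00:35Z (GREEN order of T80/T81 = order of the owners' READY lines l.6467 < l.7021). Only decl names change
(map `RENAMES-V23F.txt`: `T_X ↦ T77_X` / … / `T81_X` — one text per owner set, hence bare numbers and NO consolidating conjunction, as for T72 in V23D); built
mechanically by `mkmono23f.py` (= p2 g11's `mkmono.py`); byte-compare `bytecmp.py --map` = verbatim-modulo-map. NOT IN THIS BLOCK unless GREEN before the final-sha line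
(numbers T82+ are p3's, GREEN order): tree-backed but olean ABSENT at 00:35Z 2026-08-25 — ds-1 g11 C (HaarThirdMomentSU3Trace, HaarSixthMoment), ds-1 g13
(StrongCouplingAnalyticPressure), ds-1 g14 (StrongCouplingAllGroups, PressureDerivativeAllGroups) / g14 B (StrongCouplingAllGroupsSharp), ds-3 g14 part A
(KernelClusteringBall), ds-3 g17 B (TorusFreeEnergyRate), rb-p2 g10 (ZdAxisMassiveRate); parents not yet tree files — ds-1 g11 B / D, g10 C3 / C4, g12, g14 C, ds-3 g14
D–F, g15 H / I / L, ds-4 g11 ×2, g12 b / d, g13 (SAW cells COMPUTATIONAL — not for the index, referee F-626), rb-p2 g8 (T67a–d / T68a keep the lead's numbers), g9 rest,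
g11, g12, g13 (Langevin), rb-p1 g7 `T_O`–`T_S`, g8 `T_U`–`T_AE`, g9 `T_AF`–`T_AI`, engine-2 every-N twisted Poincaré.

HONEST FRAMING. WHAT THIS IS: bodies `Tk_… : Prop` + witnesses `Tk_…_holds`, kernel-checked with NO hypothesis, closing by TREE constants only. STRONG-COUPLING
LATTICE statements. (T77) AN ALL-COUPLING PERIMETER-TYPE BOUND FOR THE WHOLE LINKWISE CENTRE-BLIND CLASS, `SU(2)`: on every torus `(ℤ/L)^d`, `L ≥ 2`, at EVERY
tree coupling `β` (no window), for EVERY twist-blind perturbation `W` and every non-degenerate rectangle, `|⟨½ tr U_{∂R×T}⟩_{β,W,L}| ≤ tanh(2(d−1)·2|β|)^{R}`,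
`…^{max(R,T)}`, `…^{R+T−1}` (`d = 4`: `tanh(6β_W)^{R+T−1}`), every plaquette expectation `≤ tanh(2(d−1)β_W)` — Mack–Petkova `ℤ₂` domination + GKS freezing; a
PERIMETER-type bound (exponent linear in `R + T`, not `RT`): NOT an area law, says nothing about confinement. (T78) COMPLETE CONVERGENCE OF CUBE AVERAGES AT THE
WILSON POINT, `SU(2)` on `ℤ⁴`, `0 ≤ β_W ≤ 1/12`: the DLR states are a singleton `{μ}` and for every Lipschitz cylinder observable the exceedance probabilities of
the cube averages are summable (Hsu–Robbins type) and the averages converge to `∫ f dμ` almost surely — exponential tails from Gaussian concentration, no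
large-deviation principle, not a CLT. (T79) ONE STATE AT A RATE ON THE WHOLE VERTEX-STAR WINDOW, `SU(2)` on `ℤ⁴`, EVERY `0 ≤ β_W ≤ 9/25`: every finite volume
with ANY boundary field is within `4√2·K·#Δ·exp(−starRate 4 (R_G β_W)·⌊m/4⌋)` of EVERY DLR state on Lipschitz cylinders at interior depth `m` — the rate
`starRate` is a Dobrushin–Shlosman star-door artefact, not a physical correlation length. (T80) FINITE-VOLUME CLUSTERING WITH ANY BOUNDARY FIELD ON THE
WHOLE VERTEX-STAR WINDOW, `SU(2)` on `ℤ⁴`, EVERY `0 ≤ β_W ≤ 9/25`, interior form: for every finite link volume, EVERY boundary field and Lipschitz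
cylinders `F₁` (at interior depth `m`), `F₂`: `|cov_{γ_{Λ₀}(·|η)}(F₁, F₂)| ≤ 16·#Λ₁#Λ₂K₁K₂·R_G(β_W)^{min(⌊dist/4⌋, ⌊m/4⌋)}` — Kantorovich /
Lipschitz-observable form; the decay saturates at the depth of `F₁` (interior form, NOT complete analyticity); the rate is a door artefact. (T81) THE
DOBRUSHIN–SHLOSMAN CONDITION-I SHAPE FOR THE FREE ENERGY, `SU(2)` on `ℤ⁴`, EVERY `0 ≤ β_W ≤ 9/25`: for every finite link region with ANY
frozen boundary field, `|log Z_Λ(b|η) − (#T(Λ)/6)·f(b)| ≤ b·Σ_{p∈T(Λ)} min 4 (1024√2·exp(−starRate·⌊m_p/4⌋))` — volume term + a boundary-uniform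
surface term; comparison with the infinite-volume free energy per plaquette; constants are door artefacts; not complete analyticity. Every
window / radius is where a one-link or Dobrushin-type BOUND closes, not a physical transition. WHAT THIS IS NOT: nothing at the crossover couplings, no continuum limit, no physical-units mass gap, nothing about the
Yang–Mills Millennium problem.
-/

noncomputable section

namespace Summit.Ventures.YMGap

/-! ### OWNER FILE `owners/V24ConjunctDS4g12c.lean` (sha16 68d23e87f73fa6db) — section `V23F_ds4_Z2Perimeter` -/
section V23F_ds4_Z2Perimeter

/-!
Statement v1.x candidate conjunct from ds-4's gen-12 file `RobustBall/CentreBlindZ2Perimeter.lean` (TEXT for the p3 pre-stage; number / name are p3's /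
the lead's; checkable against the tree once `CentreBlindZ2Domination` (27660b8a167f) and `CentreBlindZ2Perimeter` are IN THE TREE with commits; NOT
proposed by ds-4).  ONE conjunct: `T77_CentreBlindZ2Perimeter`.  Y2 ROBUST-BALL §6(c): AN ALL-COUPLING BOUND FOR THE WHOLE LINKWISE CENTRE-BLIND CLASS
(`SU(2)`): on every torus `(ℤ/L)^d` with `L ≥ 2`, at EVERY tree coupling `β` (NO window), for EVERY twist-blind (in particular linkwise centre-blind)
perturbation `W` and every non-degenerate rectangle (`i ≠ j`, `R, T ≤ L`, `R, T ≢ 0 mod L`), `|⟨(1/2)tr U_{∂R×T}⟩_{β,W,L}| ≤ tanh(2(d−1)·2|β|)^{max(R,T)}`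
and `≤ tanh(2(d−1)·2|β|)^{R+T−1}` (`d = 4`: `tanh(6β_W)^{R+T−1}`); in particular every plaquette expectation of every member is `≤ tanh(2(d−1)β_W)`.  MECHANISM: Mack–Petkova
domination (`CentreBlindZ2Domination`) + GKS freezing of the link spins off one side of the rectangle (Chatterjee 2020 Lemma 7.2; Literature
`gksExpect_spinProduct_le_prod_tanh`).  HONEST LABEL: PERIMETER-type (exponent `max(R,T)`), NOT an area law, says nothing about confinement.
OWNER COUNTERSIGN (ds-4 g12): these bytes are the text of record from this seat; p3 may rename / renumber / fold, bodies unchanged.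
-/


section TZ2PerimeterSec

open Summit.Ventures.YMGap.RobustBall
open Literature.MathematicalPhysics.QuantumLattice (fundamentalRep)
open Literature.MathematicalPhysics.QuantumFieldTheory

/-- **T77_CentreBlindZ2Perimeter — track Y2 (seat ds-4 g12): ALL-COUPLING PERIMETER-TYPE BOUND FOR THE CENTRE-BLIND CLASS** (`SU(2)`): (i) for every
`d`, `L ≥ 2`, tree coupling `β`, twist-blind `W`, base point `x`, `i ≠ j`, `R ≤ L` and `T ≢ 0 mod L`: `|⟨(1/2)tr U_{∂R×T}⟩_{β,W,L}| ≤ tanh(2(d−1)·2|β|)^R`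
(`RobustBall.ZTwo.su2_abs_wilsonLoop_le_tanh_pow`); (ii) both sides: `R, T ≤ L`, `R, T ≢ 0 mod L` ⇒ `≤ tanh(2(d−1)·2|β|)^{max(R,T)}`
(`…su2_abs_wilsonLoop_le_tanh_pow_max`; currency shape `1 ≤ R, T`, `2R, 2T ≤ L` on every torus: `…_of_nonwrapping`, and with exponent `R + T − 1`: `…_add`); (iii) plaquettes: `|⟨W_{1×1}⟩_{β,W,L}| ≤ tanh(2(d−1)·2|β|)` (`…su2_abs_plaquette_le_tanh`); (iv) `d = 4`:
`≤ tanh(6·2|β|)^R` (`…_dim4`).  HONEST LABEL: `SU(2)` only; perimeter-type, NOT an area law; inequalities between finite-torus expectations; nothing continuum /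
spectral / Clay.  Texts: seat ds-4 (g12). -/
def T77_CentreBlindZ2Perimeter : Prop :=
  (∀ (d L : ℕ) [NeZero L] [Fact (1 < L)] (β : ℝ) (W : Perturbation d L 2), IsTwistBlind W → ∀ (x : Site d L) (i j : Fin d) (R T : ℕ),
    i ≠ j → R ≤ L → ((T : ℕ) : ZMod L) ≠ 0 →
      |W.expectation (fundamentalRep (Fin 2)) β (wilsonLoop (fundamentalRep (Fin 2)) x i j R T)| ≤ Real.tanh (2 * (d - 1 : ℕ) * (2 * |β|)) ^ R) ∧
  (∀ (d L : ℕ) [NeZero L] [Fact (1 < L)] (β : ℝ) (W : Perturbation d L 2), IsTwistBlind W → ∀ (x : Site d L) (i j : Fin d) (R T : ℕ),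
    i ≠ j → R ≤ L → T ≤ L → ((R : ℕ) : ZMod L) ≠ 0 → ((T : ℕ) : ZMod L) ≠ 0 →
      |W.expectation (fundamentalRep (Fin 2)) β (wilsonLoop (fundamentalRep (Fin 2)) x i j R T)| ≤
        Real.tanh (2 * (d - 1 : ℕ) * (2 * |β|)) ^ max R T) ∧
  (∀ (d L : ℕ) [NeZero L] [Fact (1 < L)] (β : ℝ) (W : Perturbation d L 2), IsTwistBlind W → ∀ (x : Site d L) (i j : Fin d), i ≠ j →
      |W.expectation (fundamentalRep (Fin 2)) β (wilsonLoop (fundamentalRep (Fin 2)) x i j 1 1)| ≤ Real.tanh (2 * (d - 1 : ℕ) * (2 * |β|))) ∧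
  (∀ (L : ℕ) [NeZero L] [Fact (1 < L)] (β : ℝ) (W : Perturbation 4 L 2), IsTwistBlind W → ∀ (x : Site 4 L) (i j : Fin 4) (R T : ℕ),
    i ≠ j → R ≤ L → ((T : ℕ) : ZMod L) ≠ 0 →
      |W.expectation (fundamentalRep (Fin 2)) β (wilsonLoop (fundamentalRep (Fin 2)) x i j R T)| ≤ Real.tanh (6 * (2 * |β|)) ^ R) ∧
  (∀ (d L : ℕ) [NeZero L] (β : ℝ) (W : Perturbation d L 2), IsTwistBlind W → ∀ (x : Site d L) (i j : Fin d) (R T : ℕ),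
    i ≠ j → 1 ≤ R → 1 ≤ T → 2 * R ≤ L → 2 * T ≤ L →
      |W.expectation (fundamentalRep (Fin 2)) β (wilsonLoop (fundamentalRep (Fin 2)) x i j R T)| ≤
        Real.tanh (2 * (d - 1 : ℕ) * (2 * |β|)) ^ max R T) ∧
  (∀ (d L : ℕ) [NeZero L] (β : ℝ) (W : Perturbation d L 2), IsTwistBlind W → ∀ (x : Site d L) (i j : Fin d) (R T : ℕ),
    i ≠ j → 1 ≤ R → 1 ≤ T → 2 * R ≤ L → 2 * T ≤ L →
      |W.expectation (fundamentalRep (Fin 2)) β (wilsonLoop (fundamentalRep (Fin 2)) x i j R T)| ≤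
        Real.tanh (2 * (d - 1 : ℕ) * (2 * |β|)) ^ (R + T - 1))

/-- T77_CentreBlindZ2Perimeter holds (`RobustBall.ZTwo.su2_abs_wilsonLoop_le_tanh_pow`, `…_max`, `…su2_abs_plaquette_le_tanh`, `…_dim4`; seat ds-4 g12
`…_of_nonwrapping`; text). -/
theorem T77_CentreBlindZ2Perimeter_holds : T77_CentreBlindZ2Perimeter :=
  ⟨fun _ _ _ _ β W hW _ _ _ _ _ hij hR hT => ZTwo.su2_abs_wilsonLoop_le_tanh_pow W hW β hij hR hT,
    fun _ _ _ _ β W hW _ _ _ _ _ hij hR hT hR0 hT0 => ZTwo.su2_abs_wilsonLoop_le_tanh_pow_max W hW β hij hR hT hR0 hT0,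
    fun _ _ _ _ β W hW x _ _ hij => ZTwo.su2_abs_plaquette_le_tanh W hW β x hij,
    fun _ _ _ β W hW _ _ _ _ _ hij hR hT => ZTwo.su2_abs_wilsonLoop_le_tanh_pow_dim4 W hW β hij hR hT,
    fun _ _ _ β W hW _ _ _ _ _ hij hR1 hT1 hR hT => ZTwo.su2_abs_wilsonLoop_le_tanh_pow_of_nonwrapping W hW β hij hR1 hT1 hR hT,
    fun _ _ _ β W hW _ _ _ _ _ hij hR1 hT1 hR hT => ZTwo.su2_abs_wilsonLoop_le_tanh_pow_add W hW β hij hR1 hT1 hR hT⟩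

end TZ2PerimeterSec

end V23F_ds4_Z2Perimeter

/-! ### OWNER FILE `owners/V1XConjunctsDS3g14G.lean` (sha16 ac24291bbe1e9a91) — section `V23F_ds3_CompleteConvergence` -/
section V23F_ds3_CompleteConvergence

/-!
Statement v1.x candidate conjunct from ds-3's gen-14 files, PART G (TEXT for the p2/p3 seats; checkable once `ErgodicConcentration.lean` is IN
THE TREE with its olean BUILT; NOT proposed by ds-3). Y2 ROBUST-BALL, currency C-CC (complete convergence of the cube averages at the Wilson
point). HONEST LABEL: lattice strong-coupling statement; exponential tails from Gaussian concentration, no large-deviation principle; nothing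
continuum, nothing at the Y3 couplings.
-/

open MeasureTheory Filter Topology ProbabilityTheory
open scoped NNReal
open Literature.Probability.LatticeModels hiding configShift configShift_apply
open Literature.MathematicalPhysics.QuantumLattice (fundamentalRep ZdEdge LGConfig ymGibbsMeasures configShift)
open Literature.MathematicalPhysics.QuantumFieldTheory (IsLipschitzCylinder)
open Summit.Ventures.YMGap
open Summit.Ventures.YMGap.RobustBall

/-- **T78_SU2WilsonCompleteConvergence — `SU(2)` ON `ℤ⁴`, `0 ≤ β_W ≤ 1/12`** (tree coupling `β_W/2`): the DLR states form a singleton `{μ}`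
and for every Lipschitz cylinder observable `f` (links `Δ ≠ ∅`, constant `K > 0`, `|f| ≤ M`) and every `ε > 0` the exceedance
probabilities `μ{ε ≤ |#B_n⁻¹ Σ_{x∈B_n} f∘θ_x − ∫ f dμ|}` are summable over the cubes `B_n = [−n,n]⁴`, and the cube averages converge to
`∫ f dμ` almost surely (`ErgodicConcentration.su2_wilson_complete_convergence`). -/
def T78_SU2WilsonCompleteConvergence : Prop :=
  ∀ βW : ℝ, 0 ≤ βW → βW ≤ 1 / 12 →
    ∃ μ : Measure (LGConfig 4 (Matrix.specialUnitaryGroup (Fin 2) ℂ)),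
      ymGibbsMeasures (d := 4) (fundamentalRep (Fin 2)) (βW / 2) = {μ} ∧
      ∀ {f : LGConfig 4 (Matrix.specialUnitaryGroup (Fin 2) ℂ) → ℝ} {Δ : Finset (ZdEdge 4)} {K : ℝ≥0},
        IsLipschitzCylinder (fundamentalRep (Fin 2)) f Δ K → Δ.Nonempty → 0 < K → ∀ {M : ℝ}, (∀ U, |f U| ≤ M) →
        (∀ ε : ℝ, 0 < ε →
          Summable fun n : ℕ =>
            μ.real {U | ε ≤ |(∑ x ∈ siteBox 4 n, f (configShift x U)) / (siteBox 4 n).card - ∫ U', f U' ∂μ|}) ∧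
        ∀ᵐ U ∂μ, Tendsto (fun n : ℕ => (∑ x ∈ siteBox 4 n, f (configShift x U)) / (siteBox 4 n).card) atTop
          (𝓝 (∫ U', f U' ∂μ))

/-- T78_SU2WilsonCompleteConvergence holds. -/
theorem T78_SU2WilsonCompleteConvergence_holds : T78_SU2WilsonCompleteConvergence :=
  fun _ h0 h => ErgodicConcentration.su2_wilson_complete_convergence h0 h

end V23F_ds3_CompleteConvergence

/-! ### OWNER FILE `owners/V1XConjunctsDS3g15J.lean` (sha16 2a6aa2388ad2c053) — section `V23F_ds3_BoundaryStar` -/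
section V23F_ds3_BoundaryStar

/-!
Statement v1.x candidate conjuncts from ds-3's gen-15 files, PART J (TEXT for the p2/p3 seats; checkable once
`RobustBall/StarBoundaryDecayZd.lean` is IN THE TREE; NOT proposed by ds-3). Y2 ROBUST-BALL / track (a): ONE STATE AT A RATE ON THE WHOLE
VERTEX-STAR WINDOW — for `SU(2)` lattice Yang–Mills on `ℤ⁴` at EVERY `0 ≤ β_W ≤ 9/25` a finite volume forgets its boundary field at the
Dobrushin–Shlosman star rate (interior depth form). HONEST LABEL: strong-coupling LATTICE statement; the rate `starRate 4 (R_G β_W)` is a door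
artefact; nothing continuum, nothing at the Y3 couplings.
-/

open MeasureTheory Filter Topology ProbabilityTheory
open scoped NNReal
open Literature.Probability.LatticeModels hiding configShift configShift_apply
open Literature.MathematicalPhysics.QuantumLattice (fundamentalRep ZdEdge LGConfig ymSpecification ymGibbsMeasures)
open Literature.MathematicalPhysics.QuantumFieldTheory (IsLipschitzCylinder)
open Summit.Ventures.YMGap
open Summit.Ventures.YMGap.DSWindowZd
open Summit.Ventures.YMGap.StarWindowGauge (gaugeR)
open Summit.Ventures.YMGap.RobustBall

/-- **T79_SU2WilsonBoundaryStar — `SU(2)` LATTICE YANG–MILLS ON `ℤ⁴`, EVERY `0 ≤ β_W ≤ 9/25`** (tree bare coupling `β_W/2`): for every finite link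
volume `Λ₀`, EVERY boundary field `η`, EVERY DLR state `μ`, every depth function `φ` of `Λ₀` (`φ x ≤ φ y + ‖x.1 − y.1‖_∞`, `φ > 0 ⇒ ∈ Λ₀`) and
every Lipschitz cylinder `F` (constant `K`) on links `Δ ⊆ Λ₀` with `φ ≥ m` on `Δ`:
`|∫F dγ_{Λ₀}(·|η) − ∫F dμ| ≤ 4√2 · K · #Δ · exp(−starRate 4 (R_G β_W) · ⌊m/4⌋)` (`RobustBall.su2_wilson_boundary_star`). -/
def T79_SU2WilsonBoundaryStar : Prop :=
  ∀ βW : ℝ, 0 ≤ βW → βW ≤ 9 / 25 →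
    ∀ (μ : Measure (LGConfig 4 (Matrix.specialUnitaryGroup (Fin 2) ℂ))),
      μ ∈ ymGibbsMeasures (d := 4) (fundamentalRep (Fin 2)) (βW / 2) →
    ∀ (Λ₀ : Finset (ZdEdge 4)) (η : LGConfig 4 (Matrix.specialUnitaryGroup (Fin 2) ℂ)) (φ : ZdEdge 4 → ℝ),
      (∀ x y : ZdEdge 4, φ x ≤ φ y + ‖x.1 - y.1‖) → (∀ x, 0 < φ x → x ∈ Λ₀) →
    ∀ (F : LGConfig 4 (Matrix.specialUnitaryGroup (Fin 2) ℂ) → ℝ) (Δ : Finset (ZdEdge 4)) (K : ℝ≥0) (m : ℝ),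
      IsLipschitzCylinder (fundamentalRep (Fin 2)) F Δ K → Δ ⊆ Λ₀ → (∀ x ∈ Δ, m ≤ φ x) →
      |(∫ U, F U ∂(ymSpecification (d := 4) (fundamentalRep (Fin 2)) (βW / 2) Λ₀ η)) - ∫ U, F U ∂μ| ≤
        4 * Real.sqrt 2 * K * Δ.card * Real.exp (-(starRate 4 (gaugeR βW) * ⌊m / (4 : ℕ)⌋₊))

/-- T79_SU2WilsonBoundaryStar holds. -/
theorem T79_SU2WilsonBoundaryStar_holds : T79_SU2WilsonBoundaryStar :=
  fun _ h0 h _ hμ Λ₀ η φ hφ hφΛ _ _ _ _ hF hΔ hm => su2_wilson_boundary_star h0 h hμ Λ₀ η φ hφ hφΛ hF hΔ hm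

end V23F_ds3_BoundaryStar

/-! ### OWNER FILE `owners/V1XConjunctsDS3g15K.lean` (sha16 8a845bf466578715) — section `V23F_ds3_KernelClusteringStar` -/
section V23F_ds3_KernelClusteringStar

/-!
Statement v1.x candidate conjuncts from ds-3's gen-15 files, PART K (TEXT for the p2/p3 seats; checkable once
`Literature/…/DobrushinShlosmanKernelGeometric.lean` and `RobustBall/StarKernelClusteringZd.lean` are IN THE TREE; NOT proposed by ds-3).
Y2 ROBUST-BALL / track (a), currency C-KMIX-STAR: FINITE-VOLUME CLUSTERING WITH ANY BOUNDARY FIELD ON THE WHOLE VERTEX-STAR WINDOW —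
`SU(2)` on `ℤ⁴` at EVERY `0 ≤ β_W ≤ 9/25`, interior form. HONEST LABEL: strong-coupling LATTICE statement, Kantorovich / Lipschitz-observable
form; the decay saturates at the depth of `F₁` inside the volume (interior form, not complete analyticity); nothing continuum.
-/

open MeasureTheory Filter Topology ProbabilityTheory
open scoped NNReal
open Literature.Probability.LatticeModels hiding configShift configShift_apply
open Literature.MathematicalPhysics.QuantumLattice (fundamentalRep ZdEdge LGConfig ymSpecification)
open Literature.MathematicalPhysics.QuantumFieldTheory (IsLipschitzCylinder setDistEdges)
open Summit.Ventures.YMGap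
open Summit.Ventures.YMGap.DSWindowZd
open Summit.Ventures.YMGap.StarWindowGauge (gaugeR)
open Summit.Ventures.YMGap.RobustBall

/-- **T80_SU2WilsonKernelClusteringStar — `SU(2)` LATTICE YANG–MILLS ON `ℤ⁴`, EVERY `0 ≤ β_W ≤ 9/25`** (tree bare coupling `β_W/2`): for every
finite link volume `Λ₀`, EVERY boundary field `η`, every depth function `φ` of `Λ₀` and Lipschitz cylinders `F₁` (links `Λ₁ ⊆ Λ₀` with `φ ≥ m`
on `Λ₁`, constant `K₁`), `F₂` (links `Λ₂`, constant `K₂`):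
`|cov_{γ_{Λ₀}(·|η)}(F₁, F₂)| ≤ 16 · #Λ₁ #Λ₂ K₁ K₂ · R_G(β_W)^{min(⌊dist(Λ₁,Λ₂)/4⌋, ⌊m/4⌋)}`
(`RobustBall.su2_wilson_kernel_clustering_star`). -/
def T80_SU2WilsonKernelClusteringStar : Prop :=
  ∀ βW : ℝ, 0 ≤ βW → βW ≤ 9 / 25 →
    ∀ (Λ₀ : Finset (ZdEdge 4)) (η : LGConfig 4 (Matrix.specialUnitaryGroup (Fin 2) ℂ)) (φ : ZdEdge 4 → ℝ),
      (∀ x y : ZdEdge 4, φ x ≤ φ y + ‖x.1 - y.1‖) → (∀ x, 0 < φ x → x ∈ Λ₀) →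
    ∀ (F₁ F₂ : LGConfig 4 (Matrix.specialUnitaryGroup (Fin 2) ℂ) → ℝ) (Λ₁ Λ₂ : Finset (ZdEdge 4)) (K₁ K₂ : ℝ≥0) (m : ℝ),
      IsLipschitzCylinder (fundamentalRep (Fin 2)) F₁ Λ₁ K₁ → IsLipschitzCylinder (fundamentalRep (Fin 2)) F₂ Λ₂ K₂ →
      Λ₁ ⊆ Λ₀ → (∀ x ∈ Λ₁, m ≤ φ x) →
      |cov[F₁, F₂; ymSpecification (d := 4) (fundamentalRep (Fin 2)) (βW / 2) Λ₀ η]| ≤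
        16 * Λ₁.card * Λ₂.card * ((K₁ : ℝ) * K₂) *
          gaugeR βW ^ (min (⌊setDistEdges Λ₁ Λ₂ / (4 : ℕ)⌋₊) (⌊m / (4 : ℕ)⌋₊))

/-- T80_SU2WilsonKernelClusteringStar holds. -/
theorem T80_SU2WilsonKernelClusteringStar_holds : T80_SU2WilsonKernelClusteringStar :=
  fun _ h0 h Λ₀ η φ hφ hφΛ _ _ _ _ _ _ _ hF₁ hF₂ hΛ₁ hm => su2_wilson_kernel_clustering_star h0 h Λ₀ η φ hφ hφΛ hF₁ hF₂ hΛ₁ hm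

end V23F_ds3_KernelClusteringStar

/-! ### OWNER FILE `owners/V1XConjunctsDS3g17A.lean` (sha16 b484d36f06b6b40e) — section `V23F_ds3_BoundaryFreeEnergy` -/
section V23F_ds3_BoundaryFreeEnergy

/-!
Statement v1.x candidate conjunct from ds-3's gen-17 files, PART A (TEXT for the p2/p3 seats; checkable once
`RobustBall/BoundaryFreeEnergy.lean` (p387913, ACCEPTED e9fb62b626bf) has its olean BUILT; NOT proposed by ds-3). Y2 ROBUST-BALL / DS track,
object «C-DS-I» (rb-theory: row pair 3b‴ / T14B): THE FREE ENERGY OF A FINITE REGION OF `ℤ⁴` WITH AN ARBITRARY FROZEN BOUNDARY FIELD IS THE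
VOLUME TERM PLUS A BOUNDARY-UNIFORM SURFACE TERM (Dobrushin–Shlosman Condition-I shape), `SU(2)`, EVERY `0 ≤ β_W ≤ 9/25`. HONEST LABEL:
lattice strong coupling; real couplings; the comparison is with the infinite-volume free energy per plaquette `f(b)/6`; constants are door
artefacts; nothing continuum, nothing at the Y3 couplings, nothing Clay.
-/

open MeasureTheory Filter Topology ProbabilityTheory
open scoped NNReal
open Literature.Probability.LatticeModels hiding configShift configShift_apply
open Literature.MathematicalPhysics.QuantumLattice (fundamentalRep ZdEdge ZdPlaquette LGConfig plaquettesTouching plaquetteEdges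
  wilsonBoundaryAction freeEnergyDensity)
open Literature.MathematicalPhysics.QuantumFieldTheory (haarProbability)
open Summit.Ventures.YMGap
open Summit.Ventures.YMGap.StarWindowGauge (gaugeR)
open Summit.Ventures.YMGap.RobustBall

/-- **T81_SU2BoundaryFreeEnergy — `SU(2)` LATTICE YANG–MILLS ON `ℤ⁴`, EVERY `0 ≤ β_W ≤ 9/25`** (tree coupling `b = β_W/2 ∈ [0, 9/50]`): for
every finite link volume `Λ`, EVERY boundary field `η`, every depth function `φ` of `Λ` (`φ x ≤ φ y + ‖x.1 − y.1‖_∞`, `φ > 0 ⇒ ∈ Λ`) and depths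
`m_p ≤ φ` on the links of the plaquettes touching `Λ`:
`|log Z_Λ(b|η) − (#T(Λ)/6)·f(b)| ≤ b · Σ_{p ∈ T(Λ)} min 4 (1024√2 · exp(−starRate 4 (R_G(2b)) · ⌊m_p/4⌋))`,
`Z_Λ(b|η) = ∫ exp(−b S_Λ(ζ ⊕ η_{Λᶜ})) ∏_{e∈Λ} dζ_e`, `T(Λ) = plaquettesTouching Λ`, `f = freeEnergyDensity 4 ρ`
(`BoundaryFreeEnergy.su2_abs_log_normaliser_sub_freeEnergy_le`). -/
def T81_SU2BoundaryFreeEnergy : Prop :=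
  ∀ b : ℝ, 0 ≤ b → b ≤ 9 / 50 →
    ∀ (Λ : Finset (ZdEdge 4)) (η : LGConfig 4 (Matrix.specialUnitaryGroup (Fin 2) ℂ)) (φ : ZdEdge 4 → ℝ),
      (∀ x y : ZdEdge 4, φ x ≤ φ y + ‖x.1 - y.1‖) → (∀ x, 0 < φ x → x ∈ Λ) →
    ∀ (m : ZdPlaquette 4 → ℝ), (∀ p ∈ plaquettesTouching Λ, ∀ x ∈ plaquetteEdges p, m p ≤ φ x) →
      |Real.log (∫ ζ, Real.exp (-b * wilsonBoundaryAction (fundamentalRep (Fin 2)) Λ (glueWith Λ ζ η))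
            ∂(Measure.pi fun _ : ↥Λ => haarProbability (Matrix.specialUnitaryGroup (Fin 2) ℂ))) -
          (plaquettesTouching Λ).card / 6 * freeEnergyDensity 4 (fundamentalRep (Fin 2)) b| ≤
        b * ∑ p ∈ plaquettesTouching Λ,
          min 4 (1024 * Real.sqrt 2 * Real.exp (-(starRate 4 (gaugeR (2 * b)) * ⌊m p / (4 : ℕ)⌋₊)))

/-- T81_SU2BoundaryFreeEnergy holds. -/
theorem T81_SU2BoundaryFreeEnergy_holds : T81_SU2BoundaryFreeEnergy :=
  fun _ hb0 hb Λ η φ hφ hφΛ m hm => BoundaryFreeEnergy.su2_abs_log_normaliser_sub_freeEnergy_le hb0 hb Λ η φ hφ hφΛ m hm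

end V23F_ds3_BoundaryFreeEnergy

end Summit.Ventures.YMGap

end
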